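import Summits.MatrixMultiplication.MatrixMultiplication.Theses.ProbeRankScaling
import Literature.Computability.AlgebraicComplexity.TensorRestrictionRank
import Summits.MatrixMultiplication.MatrixMultiplication.Theorems.ProbeRankScalingHalfScaleTransfer
import Summits.MatrixMultiplication.MatrixMultiplication.Theorems.ProbeRankScalingProbeRankBound

-- single-conjunct summit: mandated namespace repeats the summit name (D-0017)
set_option linter.dupNamespace false

/-!
# HalfScaleBeat — crux-strategist census of typed decompositions (stmt-MatrixMultiplication-7533)

Candidate pieces `X₁ … X_k` for a BC2-redirect of the deciding crux
`Summit.MatrixMultiplication.MatrixMultiplication.Theses.ProbeRankScaling.HalfScaleBeat`, with the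
assemblies that could be proved and the short lemmas certifying which pieces are
summit-or-harder ("Lemma W"). Nothing here is a route item; the defs are census exhibits (the audit's
`vendored-fact` / `proof.conditional` classes are expected). Verdicts: `STRATEGY-CENSUS.md` in the same
crux directory (published as `Cruxes/HalfScaleBeat/StrategistSplits.lean`).
-/

noncomputable section

namespace Summit.MatrixMultiplication.MatrixMultiplication.Cruxes.HalfScaleBeat.Strategist

open scoped BigOperators
open Literature.Computability.AlgebraicComplexity
open Summit.MatrixMultiplication.MatrixMultiplication.Theses.ProbeRankScaling (HalfScaleBeat)

/-! ## D1 — recursion-optimality ⊗ ω-gap -/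

/-- D1 piece 1 (ω-blind; provably TRUE if `ω = 2`): block recursion is optimal at scale one-half
up to `n^ε` — every decomposition of `⟨n,n,n⟩` with all probe ranks `≤ √n` has at least
`n^{3/2-ε} · R(⟨⌊√n⌋⟩)` terms, for all large `n`. -/
def RecursionOptimalAtHalf : Prop :=
  ∀ ε : ℝ, 0 < ε → ∃ n₀ : ℕ, ∀ n : ℕ, n₀ ≤ n → ∀ (r : ℕ) (w u v : Fin r → Fin n × Fin n → ℂ),
    matMulTensor ℂ n n n = ∑ l, triad (w l) (u l) (v l) →
    (∀ l, (Matrix.of (Function.curry (w l))).rank ^ 2 ≤ n ∧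
      (Matrix.of (Function.curry (u l))).rank ^ 2 ≤ n ∧
      (Matrix.of (Function.curry (v l))).rank ^ 2 ≤ n) →
    (n : ℝ) ^ ((3 : ℝ) / 2 - ε) *
        (tensorRank (matMulTensor ℂ (Nat.sqrt n) (Nat.sqrt n) (Nat.sqrt n)) : ℝ) ≤ (r : ℝ)

/-- D1 piece 2: `ω(ℂ) > 2` — the negation of the summit in its natural strict form. -/
def OmegaGtTwo : Prop := 2 < omega ℂ

/-- (c)-violation certificate for D1 piece 2: it refutes the summit in two lines. -/
theorem omegaGtTwo_refutes : OmegaGtTwo → ¬ _root_.MatrixMultiplication := by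
  intro h hM
  unfold OmegaGtTwo at h
  rw [MatrixMultiplication_iff] at hM
  rw [hM] at h
  exact lt_irrefl _ h

/-- Cast bookkeeping: `((m²:ℕ):ℝ)^e = (m:ℝ)^(2e)`. -/
theorem cast_sq_rpow (m : ℕ) (e : ℝ) : (((m ^ 2 : ℕ) : ℝ)) ^ e = (m : ℝ) ^ (2 * e) := by
  have hm : (0 : ℝ) ≤ m := Nat.cast_nonneg m
  push_cast
  rw [show ((m : ℝ) ^ 2) = (m : ℝ) ^ (2 : ℝ) by norm_cast, ← Real.rpow_mul hm]

/-- D1 assembly (non-trivial, proved): recursion-optimality at scale one-half and `ω > 2` give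
`HalfScaleBeat` with `δ = (ω-2)/4`, along the perfect squares. -/
theorem halfScaleBeat_of_recursionOptimal_of_omegaGtTwo
    (h₁ : RecursionOptimalAtHalf) (h₂ : OmegaGtTwo) : HalfScaleBeat := by
  have hδ₀ : 0 < omega ℂ - 2 := by unfold OmegaGtTwo at h₂; linarith
  obtain ⟨n₀, hn₀⟩ := h₁ ((omega ℂ - 2) / 4) (by linarith)
  refine ⟨(omega ℂ - 2) / 4, by linarith, fun N₀ => ?_⟩
  obtain ⟨m, hmN, hmn, hm2⟩ : ∃ m : ℕ, N₀ ≤ m ∧ n₀ ≤ m ∧ 2 ≤ m :=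
    ⟨max (max N₀ n₀) 2, le_trans (le_max_left _ _) (le_max_left _ _),
      le_trans (le_max_right _ _) (le_max_left _ _), le_max_right _ _⟩
  refine ⟨m ^ 2, hmN.trans (Nat.le_self_pow two_ne_zero _), fun r w u v hdec hrank => ?_⟩
  have key := hn₀ (m ^ 2) (hmn.trans (Nat.le_self_pow two_ne_zero _)) r w u v hdec hrank
  rw [Nat.sqrt_eq' m] at key
  have hR : (m : ℝ) ^ omega ℂ ≤ (tensorRank (matMulTensor ℂ m m m) : ℝ) :=
    rpow_omega_le_tensorRank_matMulTensor ℂ hm2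
  have hmpos : (0 : ℝ) < m := by exact_mod_cast lt_of_lt_of_le (by norm_num) hm2
  have hpow_nonneg : (0 : ℝ) ≤ ((m ^ 2 : ℕ) : ℝ) ^ ((3 : ℝ) / 2 - (omega ℂ - 2) / 4) :=
    Real.rpow_nonneg (Nat.cast_nonneg _) _
  calc (((m ^ 2 : ℕ) : ℝ)) ^ ((5 : ℝ) / 2 + (omega ℂ - 2) / 4)
      = (m : ℝ) ^ (2 * ((3 : ℝ) / 2 - (omega ℂ - 2) / 4)) * (m : ℝ) ^ omega ℂ := by
        rw [cast_sq_rpow, ← Real.rpow_add hmpos]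
        congr 1
        ring
    _ = (((m ^ 2 : ℕ) : ℝ)) ^ ((3 : ℝ) / 2 - (omega ℂ - 2) / 4) * (m : ℝ) ^ omega ℂ := by
        rw [cast_sq_rpow]
    _ ≤ (((m ^ 2 : ℕ) : ℝ)) ^ ((3 : ℝ) / 2 - (omega ℂ - 2) / 4) *
          (tensorRank (matMulTensor ℂ m m m) : ℝ) :=
        mul_le_mul_of_nonneg_left hR hpow_nonneg
    _ ≤ r := key


/-! ## The obstruction ("Lemma W") -/

/-- RESTATED certificate: the crux alone refutes the summit (route glue `closes` with its two
proved supports). -/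
theorem halfScaleBeat_refutes : HalfScaleBeat → ¬ _root_.MatrixMultiplication := fun hX =>
  Summit.MatrixMultiplication.MatrixMultiplication.Theses.ProbeRankScaling.closes hX
    Summit.MatrixMultiplication.MatrixMultiplication.Theorems.halfScaleTransfer_proof
    Summit.MatrixMultiplication.MatrixMultiplication.Theses.ProbeRankScaling.SuperquadraticInfinitelyOften_holds

/-- **Lemma W.** In any proved two-piece split of `HalfScaleBeat`, a piece that provably holds in
the `ω = 2` world forces its partner to refute the summit, i.e. to be summit-or-harder. -/
theorem lemmaW {X₁ X₂ : Prop} (hasm : X₁ → X₂ → HalfScaleBeat)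
    (h₁ : _root_.MatrixMultiplication → X₁) : X₂ → ¬ _root_.MatrixMultiplication :=
  fun h₂ hM => halfScaleBeat_refutes (hasm (h₁ hM) h₂) hM

/-- D1 piece 1 holds in the `ω = 2` world (one-leg law + `R(⟨a⟩) ≤ C·a^{2+ε}`), so by `lemmaW`
its partner in ANY proved split is summit-or-harder. -/
theorem recursionOptimalAtHalf_of_mm (hM : _root_.MatrixMultiplication) :
    RecursionOptimalAtHalf := by
  rw [MatrixMultiplication_iff] at hM
  intro ε hε
  obtain ⟨C, hC, hCb⟩ := exists_tensorRank_matMulTensor_le_rpow ℂ hε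
  rw [hM] at hCb
  have hev : ∀ᶠ n : ℕ in Filter.atTop, C ≤ (n : ℝ) ^ (ε / 2) := by
    have ht : Filter.Tendsto (fun n : ℕ => (n : ℝ) ^ (ε / 2)) Filter.atTop Filter.atTop :=
      (tendsto_rpow_atTop (by linarith)).comp tendsto_natCast_atTop_atTop
    exact ht.eventually_ge_atTop C
  obtain ⟨N, hN⟩ := Filter.eventually_atTop.1 hev
  refine ⟨max N 1, fun n hn r w u v hdec hrank => ?_⟩
  have hnN : N ≤ n := le_trans (le_max_left _ _) hn
  have hn1 : 1 ≤ n := le_trans (le_max_right _ _) hn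
  have hs1 : 1 ≤ Nat.sqrt n := by rw [Nat.le_sqrt]; simpa using hn1
  have hss : Nat.sqrt n * Nat.sqrt n ≤ n := Nat.sqrt_le n
  -- the one-leg law on the `u`-leg at probe rank `⌊√n⌋`
  have hone : n ^ 3 ≤ Nat.sqrt n * r := by
    refine Summit.MatrixMultiplication.MatrixMultiplication.Theorems.probeRankBound_proof
      n (Nat.sqrt n) r w u v hdec ?_
    intro l
    have := (hrank l).2.1
    rw [Nat.le_sqrt]
    simpa [sq] using this
  have hn0 : (0 : ℝ) < n := by exact_mod_cast hn1
  have hs0 : (0 : ℝ) < Nat.sqrt n := by exact_mod_cast hs1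
  have hsle : ((Nat.sqrt n : ℕ) : ℝ) ≤ (n : ℝ) ^ ((1 : ℝ) / 2) := by
    have h1 : ((Nat.sqrt n : ℕ) : ℝ) * (Nat.sqrt n : ℕ) ≤ (n : ℝ) := by exact_mod_cast hss
    have h2 : Real.sqrt (((Nat.sqrt n : ℕ) : ℝ) * (Nat.sqrt n : ℕ)) ≤ Real.sqrt n :=
      Real.sqrt_le_sqrt h1
    rw [Real.sqrt_mul_self hs0.le, Real.sqrt_eq_rpow] at h2
    exact h2
  have hR' : (tensorRank (matMulTensor ℂ (Nat.sqrt n) (Nat.sqrt n) (Nat.sqrt n)) : ℝ) ≤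
      C * (n : ℝ) ^ (1 + ε / 2) := by
    refine (hCb (Nat.sqrt n) hs1).trans ?_
    refine mul_le_mul_of_nonneg_left ?_ hC.le
    calc ((Nat.sqrt n : ℕ) : ℝ) ^ (2 + ε) ≤ ((n : ℝ) ^ ((1 : ℝ) / 2)) ^ (2 + ε) :=
          Real.rpow_le_rpow hs0.le hsle (by linarith)
      _ = (n : ℝ) ^ (1 + ε / 2) := by rw [← Real.rpow_mul hn0.le]; congr 1; ring
  -- `r ≥ n^{5/2}`
  have hr : (n : ℝ) ^ ((5 : ℝ) / 2) ≤ r := by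
    have h3 : (n : ℝ) ^ (3 : ℝ) ≤ ((Nat.sqrt n : ℕ) : ℝ) * r := by
      have h' : ((n ^ 3 : ℕ) : ℝ) ≤ ((Nat.sqrt n * r : ℕ) : ℝ) := by exact_mod_cast hone
      push_cast at h'
      rw [show (n : ℝ) ^ (3 : ℝ) = (n : ℝ) ^ (3 : ℕ) by exact_mod_cast Real.rpow_natCast (n : ℝ) 3]
      exact h'
    have h4 : (n : ℝ) ^ (3 : ℝ) ≤ (n : ℝ) ^ ((1 : ℝ) / 2) * r :=
      h3.trans (mul_le_mul_of_nonneg_right hsle (Nat.cast_nonneg r))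
    have h5 : (n : ℝ) ^ ((1 : ℝ) / 2) * (n : ℝ) ^ ((5 : ℝ) / 2) = (n : ℝ) ^ (3 : ℝ) := by
      rw [← Real.rpow_add hn0]; norm_num
    have hhalf : (0 : ℝ) < (n : ℝ) ^ ((1 : ℝ) / 2) := Real.rpow_pos_of_pos hn0 _
    rw [← h5] at h4
    exact le_of_mul_le_mul_left h4 hhalf
  -- combine
  have hCn : C ≤ (n : ℝ) ^ (ε / 2) := hN n hnN
  calc (n : ℝ) ^ ((3 : ℝ) / 2 - ε) *
        (tensorRank (matMulTensor ℂ (Nat.sqrt n) (Nat.sqrt n) (Nat.sqrt n)) : ℝ)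
      ≤ (n : ℝ) ^ ((3 : ℝ) / 2 - ε) * (C * (n : ℝ) ^ (1 + ε / 2)) :=
        mul_le_mul_of_nonneg_left hR' (Real.rpow_nonneg hn0.le _)
    _ = C * (n : ℝ) ^ ((5 : ℝ) / 2 - ε / 2) := by
        rw [mul_left_comm, ← Real.rpow_add hn0]
        congr 1
        congr 1
        ring
    _ ≤ (n : ℝ) ^ (ε / 2) * (n : ℝ) ^ ((5 : ℝ) / 2 - ε / 2) :=
        mul_le_mul_of_nonneg_right hCn (Real.rpow_nonneg hn0.le _)
    _ = (n : ℝ) ^ ((5 : ℝ) / 2) := by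
        rw [← Real.rpow_add hn0]
        congr 1
        ring
    _ ≤ r := hr

/-- Hence (D1, certified): the partner of `RecursionOptimalAtHalf` in any proved split refutes the
summit. -/
theorem partner_of_recursionOptimalAtHalf_refutes {X₂ : Prop}
    (hasm : RecursionOptimalAtHalf → X₂ → HalfScaleBeat) : X₂ → ¬ _root_.MatrixMultiplication :=
  lemmaW hasm recursionOptimalAtHalf_of_mm


/-! ## D6 — finite excess ⊗ super-multiplicativity (the tensor-power architecture) -/

/-- D6 piece 1 (finite, decidable in principle, open): `R_2(4) ≥ 33` — no decomposition of
`⟨4,4,4⟩` over `ℂ` with all probe ranks `≤ 2` has only `32 = 4³/2` terms (the one-leg count);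
the smallest open "perfect uniform scheme" case `(n, ρ, r) = (4, 2, 32)` of the route text. -/
def FiniteExcessAtFour : Prop :=
  ∀ (r : ℕ) (w u v : Fin r → Fin 4 × Fin 4 → ℂ),
    matMulTensor ℂ 4 4 4 = ∑ l, triad (w l) (u l) (v l) →
    (∀ l, (Matrix.of (Function.curry (w l))).rank ≤ 2 ∧
      (Matrix.of (Function.curry (u l))).rank ≤ 2 ∧
      (Matrix.of (Function.curry (v l))).rank ≤ 2) → 33 ≤ r

/-- D6 piece 2 (structural; NO known mechanism, unrestricted analogue false): super-multiplicativity
of the scale-one-half restricted rank along squares — a decomposition of `⟨(m₁m₂)²⟩` with all probe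
ranks `≤ m₁m₂` and `r` terms yields decompositions of `⟨m₁²⟩` (ranks `≤ m₁`, `r₁` terms) and of
`⟨m₂²⟩` (ranks `≤ m₂`, `r₂` terms) with `r₁·r₂ ≤ r`; i.e. `f(m₁m₂) ≥ f(m₁)·f(m₂)` for
`f(m) := R_m(m²)` (Kronecker closure gives the reverse inequality). -/
def SquareSupermultiplicative : Prop :=
  ∀ (m₁ m₂ r : ℕ) (w u v : Fin r → Fin ((m₁ * m₂) ^ 2) × Fin ((m₁ * m₂) ^ 2) → ℂ),
    matMulTensor ℂ ((m₁ * m₂) ^ 2) ((m₁ * m₂) ^ 2) ((m₁ * m₂) ^ 2) =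
      ∑ l, triad (w l) (u l) (v l) →
    (∀ l, (Matrix.of (Function.curry (w l))).rank ≤ m₁ * m₂ ∧
      (Matrix.of (Function.curry (u l))).rank ≤ m₁ * m₂ ∧
      (Matrix.of (Function.curry (v l))).rank ≤ m₁ * m₂) →
    ∃ (r₁ r₂ : ℕ) (w₁ u₁ v₁ : Fin r₁ → Fin (m₁ ^ 2) × Fin (m₁ ^ 2) → ℂ)
      (w₂ u₂ v₂ : Fin r₂ → Fin (m₂ ^ 2) × Fin (m₂ ^ 2) → ℂ),
      matMulTensor ℂ (m₁ ^ 2) (m₁ ^ 2) (m₁ ^ 2) = ∑ l, triad (w₁ l) (u₁ l) (v₁ l) ∧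
      (∀ l, (Matrix.of (Function.curry (w₁ l))).rank ≤ m₁ ∧
        (Matrix.of (Function.curry (u₁ l))).rank ≤ m₁ ∧
        (Matrix.of (Function.curry (v₁ l))).rank ≤ m₁) ∧
      matMulTensor ℂ (m₂ ^ 2) (m₂ ^ 2) (m₂ ^ 2) = ∑ l, triad (w₂ l) (u₂ l) (v₂ l) ∧
      (∀ l, (Matrix.of (Function.curry (w₂ l))).rank ≤ m₂ ∧
        (Matrix.of (Function.curry (u₂ l))).rank ≤ m₂ ∧
        (Matrix.of (Function.curry (v₂ l))).rank ≤ m₂) ∧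
      r₁ * r₂ ≤ r

/-- D6 tower lemma (the induction = the tensor-power trick run on LOWER bounds): along
`n = (2^k)²` the two pieces force `33^k` terms at probe rank `2^k`. -/
theorem tower_bound (h₁ : FiniteExcessAtFour) (h₂ : SquareSupermultiplicative) (k : ℕ) :
    ∀ (r : ℕ) (w u v : Fin r → Fin ((2 ^ k) ^ 2) × Fin ((2 ^ k) ^ 2) → ℂ),
      matMulTensor ℂ ((2 ^ k) ^ 2) ((2 ^ k) ^ 2) ((2 ^ k) ^ 2) = ∑ l, triad (w l) (u l) (v l) →
      (∀ l, (Matrix.of (Function.curry (w l))).rank ≤ 2 ^ k ∧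
        (Matrix.of (Function.curry (u l))).rank ≤ 2 ^ k ∧
        (Matrix.of (Function.curry (v l))).rank ≤ 2 ^ k) → 33 ^ k ≤ r := by
  induction k with
  | zero =>
      intro r w u v hdec _
      rw [pow_zero]
      rcases Nat.eq_zero_or_pos r with hr | hr
      · subst hr
        exfalso
        have h := congrFun (congrFun (congrFun hdec (⟨0, by norm_num⟩, ⟨0, by norm_num⟩))
          (⟨0, by norm_num⟩, ⟨0, by norm_num⟩)) (⟨0, by norm_num⟩, ⟨0, by norm_num⟩)
        simp [matMulTensor] at h
      · exact hr
  | succ k ih =>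
      intro r w u v hdec hrank
      obtain ⟨r₁, r₂, w₁, u₁, v₁, w₂, u₂, v₂, hdec₁, hrank₁, hdec₂, hrank₂, hrr⟩ :=
        h₂ (2 ^ k) 2 r w u v hdec hrank
      have hb₁ : 33 ^ k ≤ r₁ := ih r₁ w₁ u₁ v₁ hdec₁ hrank₁
      have hb₂ : 33 ≤ r₂ := h₁ r₂ w₂ u₂ v₂ hdec₂ hrank₂
      calc 33 ^ (k + 1) = 33 ^ k * 33 := pow_succ 33 k
        _ ≤ r₁ * r₂ := Nat.mul_le_mul hb₁ hb₂
        _ ≤ r := hrr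

/-- Numerical certificate for the D6 exponent: `4^{5/2 + 1/64} ≤ 33`. -/
theorem four_rpow_le_33 : (4 : ℝ) ^ ((5 : ℝ) / 2 + 1 / 64) ≤ 33 := by
  have h32 : (4 : ℝ) ^ ((5 : ℝ) / 2) = 32 := by
    rw [show (4 : ℝ) = (2 : ℝ) ^ (2 : ℝ) by norm_num, ← Real.rpow_mul (by norm_num)]
    norm_num
  have hsmall : (4 : ℝ) ^ ((1 : ℝ) / 64) ≤ 33 / 32 := by
    have h4 : (0 : ℝ) ≤ (4 : ℝ) ^ ((1 : ℝ) / 64) := Real.rpow_nonneg (by norm_num) _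
    rw [← pow_le_pow_iff_left₀ h4 (by norm_num) (by norm_num : (64 : ℕ) ≠ 0)]
    rw [← Real.rpow_natCast, ← Real.rpow_mul (by norm_num)]
    norm_num
  rw [Real.rpow_add (by norm_num), h32]
  calc (32 : ℝ) * (4 : ℝ) ^ ((1 : ℝ) / 64) ≤ 32 * (33 / 32) :=
        mul_le_mul_of_nonneg_left hsmall (by norm_num)
    _ = 33 := by norm_num

/-- D6 assembly (non-trivial, proved): `FiniteExcessAtFour ∧ SquareSupermultiplicative →
HalfScaleBeat` with `δ = 1/64` along `n = 4^k`. Formally passes (a)(b)(c); rejected in the census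
as NOT an honest reduction (piece 2 has no mechanism and its unrestricted analogue
`R(⟨m₁m₂⟩) ≥ R(⟨m₁⟩)R(⟨m₂⟩)` is false: `R(⟨4,4,4⟩) ≤ 48 < 49 = R(⟨2,2,2⟩)²`). -/
theorem halfScaleBeat_of_finiteExcess_of_supermult (h₁ : FiniteExcessAtFour)
    (h₂ : SquareSupermultiplicative) : HalfScaleBeat := by
  refine ⟨(1 : ℝ) / 64, by norm_num, fun N₀ => ⟨(2 ^ N₀) ^ 2, ?_, fun r w u v hdec hrank => ?_⟩⟩
  · calc N₀ ≤ 2 ^ N₀ := (Nat.lt_two_pow_self).le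
      _ ≤ (2 ^ N₀) ^ 2 := Nat.le_self_pow two_ne_zero _
  · have hk : 33 ^ N₀ ≤ r := by
      refine tower_bound h₁ h₂ N₀ r w u v hdec (fun l => ?_)
      obtain ⟨hw, hu, hv⟩ := hrank l
      exact ⟨(Nat.pow_le_pow_iff_left two_ne_zero).1 hw,
        (Nat.pow_le_pow_iff_left two_ne_zero).1 hu, (Nat.pow_le_pow_iff_left two_ne_zero).1 hv⟩
    have hcast : ((((2 ^ N₀) ^ 2 : ℕ)) : ℝ) = (4 : ℝ) ^ (N₀ : ℝ) := by
      rw [Real.rpow_natCast]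
      push_cast
      rw [← pow_mul, mul_comm, pow_mul]
      norm_num
    rw [hcast, ← Real.rpow_mul (by norm_num : (0 : ℝ) ≤ 4), mul_comm,
      Real.rpow_mul (by norm_num : (0 : ℝ) ≤ 4), Real.rpow_natCast]
    calc ((4 : ℝ) ^ ((5 : ℝ) / 2 + 1 / 64)) ^ N₀ ≤ (33 : ℝ) ^ N₀ :=
          pow_le_pow_left₀ (Real.rpow_nonneg (by norm_num) _) four_rpow_le_33 N₀
      _ ≤ r := by exact_mod_cast hk


/-- D6 collapses under (c): piece 1 is a printed FACT — `33 ≤ R(⟨4,4,4⟩) ≤ 49` (Bläser 2003,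
J. Complexity 19, p. 45; Thm 14 there even gives `2mn+2n-m-2 = 34`) — since a restricted scheme is
a scheme. -/
theorem finiteExcessAtFour_of_rank_ge (h33 : 33 ≤ tensorRank (matMulTensor ℂ 4 4 4)) :
    FiniteExcessAtFour := by
  intro r w u v hdec _
  exact h33.trans (tensorRank_le_of_eq_sum w u v hdec)

/-- … hence piece 2 ALONE is summit-or-harder: given Bläser's printed bound it refutes the summit
(through the proved D6 assembly and the route glue). -/
theorem squareSupermultiplicative_refutes_of_blaser2003
    (h33 : 33 ≤ tensorRank (matMulTensor ℂ 4 4 4)) :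
    SquareSupermultiplicative → ¬ _root_.MatrixMultiplication := fun h₂ =>
  halfScaleBeat_refutes
    (halfScaleBeat_of_finiteExcess_of_supermult (finiteExcessAtFour_of_rank_ge h33) h₂)

/-! ## D6′ — the same architecture one base up (formally passes (a)(b)(c); withheld, see census) -/

/-- D6′ piece 1 (finite, OPEN: no printed bound beyond the one-leg count `3⁵ = 243`;
`R(⟨9,9,9⟩) ≥ 2.5·81 − 27 = 175` is useless here): `R_3(9) ≥ 244`. -/
def FiniteExcessAtNine : Prop :=
  ∀ (r : ℕ) (w u v : Fin r → Fin 9 × Fin 9 → ℂ),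
    matMulTensor ℂ 9 9 9 = ∑ l, triad (w l) (u l) (v l) →
    (∀ l, (Matrix.of (Function.curry (w l))).rank ≤ 3 ∧
      (Matrix.of (Function.curry (u l))).rank ≤ 3 ∧
      (Matrix.of (Function.curry (v l))).rank ≤ 3) → 244 ≤ r

/-- D6′ piece 2: super-multiplicativity of `f(m) = R_m(m²)` for factors `m₁, m₂ ≥ 3` only (so that
Bläser's `R(⟨4,4,4⟩) ≥ 33` no longer makes it summit-hard by itself). Mechanism-free; predicts
`R_3(9) ≤ 3^{3+ω} < 366`. -/
def LargeSquareSupermultiplicative : Prop :=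
  ∀ (m₁ m₂ r : ℕ), 3 ≤ m₁ → 3 ≤ m₂ →
    ∀ (w u v : Fin r → Fin ((m₁ * m₂) ^ 2) × Fin ((m₁ * m₂) ^ 2) → ℂ),
    matMulTensor ℂ ((m₁ * m₂) ^ 2) ((m₁ * m₂) ^ 2) ((m₁ * m₂) ^ 2) =
      ∑ l, triad (w l) (u l) (v l) →
    (∀ l, (Matrix.of (Function.curry (w l))).rank ≤ m₁ * m₂ ∧
      (Matrix.of (Function.curry (u l))).rank ≤ m₁ * m₂ ∧
      (Matrix.of (Function.curry (v l))).rank ≤ m₁ * m₂) →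
    ∃ (r₁ r₂ : ℕ) (w₁ u₁ v₁ : Fin r₁ → Fin (m₁ ^ 2) × Fin (m₁ ^ 2) → ℂ)
      (w₂ u₂ v₂ : Fin r₂ → Fin (m₂ ^ 2) × Fin (m₂ ^ 2) → ℂ),
      matMulTensor ℂ (m₁ ^ 2) (m₁ ^ 2) (m₁ ^ 2) = ∑ l, triad (w₁ l) (u₁ l) (v₁ l) ∧
      (∀ l, (Matrix.of (Function.curry (w₁ l))).rank ≤ m₁ ∧
        (Matrix.of (Function.curry (u₁ l))).rank ≤ m₁ ∧
        (Matrix.of (Function.curry (v₁ l))).rank ≤ m₁) ∧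
      matMulTensor ℂ (m₂ ^ 2) (m₂ ^ 2) (m₂ ^ 2) = ∑ l, triad (w₂ l) (u₂ l) (v₂ l) ∧
      (∀ l, (Matrix.of (Function.curry (w₂ l))).rank ≤ m₂ ∧
        (Matrix.of (Function.curry (u₂ l))).rank ≤ m₂ ∧
        (Matrix.of (Function.curry (v₂ l))).rank ≤ m₂) ∧
      r₁ * r₂ ≤ r

/-- D6′ tower lemma along `n = (3^{k+1})²`. -/
theorem tower_bound9 (h₁ : FiniteExcessAtNine) (h₂ : LargeSquareSupermultiplicative) (k : ℕ) :
    ∀ (r : ℕ) (w u v : Fin r → Fin ((3 ^ (k + 1)) ^ 2) × Fin ((3 ^ (k + 1)) ^ 2) → ℂ),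
      matMulTensor ℂ ((3 ^ (k + 1)) ^ 2) ((3 ^ (k + 1)) ^ 2) ((3 ^ (k + 1)) ^ 2) =
        ∑ l, triad (w l) (u l) (v l) →
      (∀ l, (Matrix.of (Function.curry (w l))).rank ≤ 3 ^ (k + 1) ∧
        (Matrix.of (Function.curry (u l))).rank ≤ 3 ^ (k + 1) ∧
        (Matrix.of (Function.curry (v l))).rank ≤ 3 ^ (k + 1)) → 244 ^ (k + 1) ≤ r := by
  induction k with
  | zero =>
      intro r w u v hdec hrank
      exact h₁ r w u v hdec hrank
  | succ k ih =>
      intro r w u v hdec hrank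
      have h3 : 3 ≤ 3 ^ (k + 1) := by
        calc 3 = 3 ^ 1 := (pow_one 3).symm
          _ ≤ 3 ^ (k + 1) := Nat.pow_le_pow_right (by norm_num) (by omega)
      obtain ⟨r₁, r₂, w₁, u₁, v₁, w₂, u₂, v₂, hdec₁, hrank₁, hdec₂, hrank₂, hrr⟩ :=
        h₂ (3 ^ (k + 1)) 3 r h3 le_rfl w u v hdec hrank
      have hb₁ : 244 ^ (k + 1) ≤ r₁ := ih r₁ w₁ u₁ v₁ hdec₁ hrank₁
      have hb₂ : 244 ≤ r₂ := h₁ r₂ w₂ u₂ v₂ hdec₂ hrank₂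
      calc 244 ^ (k + 1 + 1) = 244 ^ (k + 1) * 244 := pow_succ 244 (k + 1)
        _ ≤ r₁ * r₂ := Nat.mul_le_mul hb₁ hb₂
        _ ≤ r := hrr

/-- Numerical certificate for D6′: `9^{5/2 + 1/1944} ≤ 244` (Bernoulli: `(1+1/243)^1944 ≥ 9`). -/
theorem nine_rpow_le_244 : (9 : ℝ) ^ ((5 : ℝ) / 2 + 1 / 1944) ≤ 244 := by
  have h243 : (9 : ℝ) ^ ((5 : ℝ) / 2) = 243 := by
    rw [show (9 : ℝ) = (3 : ℝ) ^ (2 : ℝ) by norm_num, ← Real.rpow_mul (by norm_num)]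
    norm_num
  have hsmall : (9 : ℝ) ^ ((1 : ℝ) / 1944) ≤ 244 / 243 := by
    have h9 : (0 : ℝ) ≤ (9 : ℝ) ^ ((1 : ℝ) / 1944) := Real.rpow_nonneg (by norm_num) _
    rw [← pow_le_pow_iff_left₀ h9 (by norm_num) (by norm_num : (1944 : ℕ) ≠ 0)]
    rw [← Real.rpow_natCast, ← Real.rpow_mul (by norm_num)]
    have hB := one_add_mul_le_pow (show (-2 : ℝ) ≤ 1 / 243 by norm_num) 1944
    norm_num at hB ⊢
    linarith
  rw [Real.rpow_add (by norm_num), h243]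
  calc (243 : ℝ) * (9 : ℝ) ^ ((1 : ℝ) / 1944) ≤ 243 * (244 / 243) :=
        mul_le_mul_of_nonneg_left hsmall (by norm_num)
    _ = 244 := by norm_num

/-- D6′ assembly (proved): `FiniteExcessAtNine ∧ LargeSquareSupermultiplicative → HalfScaleBeat`
with `δ = 1/1944` along `n = 9^{k+1}`. -/
theorem halfScaleBeat_of_finiteExcessAtNine_of_largeSupermult (h₁ : FiniteExcessAtNine)
    (h₂ : LargeSquareSupermultiplicative) : HalfScaleBeat := by
  refine ⟨(1 : ℝ) / 1944, by norm_num, fun N₀ => ⟨(3 ^ (N₀ + 1)) ^ 2, ?_, fun r w u v hdec hrank => ?_⟩⟩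
  · calc N₀ ≤ 3 ^ N₀ := (Nat.lt_pow_self (by norm_num : 1 < 3)).le
      _ ≤ 3 ^ (N₀ + 1) := Nat.pow_le_pow_right (by norm_num) (by omega)
      _ ≤ (3 ^ (N₀ + 1)) ^ 2 := Nat.le_self_pow two_ne_zero _
  · have hk : 244 ^ (N₀ + 1) ≤ r := by
      refine tower_bound9 h₁ h₂ N₀ r w u v hdec (fun l => ?_)
      obtain ⟨hw, hu, hv⟩ := hrank l
      exact ⟨(Nat.pow_le_pow_iff_left two_ne_zero).1 hw,
        (Nat.pow_le_pow_iff_left two_ne_zero).1 hu, (Nat.pow_le_pow_iff_left two_ne_zero).1 hv⟩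
    have hcast : ((((3 ^ (N₀ + 1)) ^ 2 : ℕ)) : ℝ) = (9 : ℝ) ^ ((N₀ + 1 : ℕ) : ℝ) := by
      rw [Real.rpow_natCast]
      push_cast
      rw [← pow_mul, mul_comm, pow_mul]
      norm_num
    rw [hcast, ← Real.rpow_mul (by norm_num : (0 : ℝ) ≤ 9), mul_comm,
      Real.rpow_mul (by norm_num : (0 : ℝ) ≤ 9), Real.rpow_natCast]
    calc ((9 : ℝ) ^ ((5 : ℝ) / 2 + 1 / 1944)) ^ (N₀ + 1) ≤ (244 : ℝ) ^ (N₀ + 1) :=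
          pow_le_pow_left₀ (Real.rpow_nonneg (by norm_num) _) nine_rpow_le_244 (N₀ + 1)
      _ ≤ r := by exact_mod_cast hk


/-! ## D2 / D4 — uniformised and smaller-scale variants (costumes / single pieces) -/

/-- D2 candidate piece: `HalfScaleBeat` restricted to UNIFORM schemes (every probe rank in
`[√n/2 - 1, √n]`). Equivalent to `HalfScaleBeat` by the free `±F` splitting
(`u = (u+F) - F` with `F` a disjoint rank-`⌊√n/2⌋` block, on each leg: 8× terms), hence a costume:
(c) fails in substance although the mechanical probe cannot see it. -/
def UniformHalfScaleBeat : Prop :=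
  ∃ δ : ℝ, 0 < δ ∧ ∀ n₀ : ℕ, ∃ n : ℕ, n₀ ≤ n ∧ ∀ (r : ℕ) (w u v : Fin r → Fin n × Fin n → ℂ),
    matMulTensor ℂ n n n = ∑ l, triad (w l) (u l) (v l) →
    (∀ l, (Matrix.of (Function.curry (w l))).rank ^ 2 ≤ n ∧
      (Matrix.of (Function.curry (u l))).rank ^ 2 ≤ n ∧
      (Matrix.of (Function.curry (v l))).rank ^ 2 ≤ n) →
    (∀ l, n ≤ 4 * ((Matrix.of (Function.curry (w l))).rank + 1) ^ 2 ∧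
      n ≤ 4 * ((Matrix.of (Function.curry (u l))).rank + 1) ^ 2 ∧
      n ≤ 4 * ((Matrix.of (Function.curry (v l))).rank + 1) ^ 2) →
    (n : ℝ) ^ ((5 : ℝ) / 2 + δ) ≤ (r : ℝ)

/-- D4 candidate piece: the same beat at scale one-third (`rank³ ≤ n`, baseline `n^{8/3}`).
By Kronecker closure with the schoolbook factor it IMPLIES `HalfScaleBeat` on its own (saturation
propagates downward in the scale), so any partner is not load-bearing ((a) fails) — and it is
itself summit-or-harder. -/
def ThirdScaleBeat : Prop :=
  ∃ δ : ℝ, 0 < δ ∧ ∀ n₀ : ℕ, ∃ n : ℕ, n₀ ≤ n ∧ ∀ (r : ℕ) (w u v : Fin r → Fin n × Fin n → ℂ),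
    matMulTensor ℂ n n n = ∑ l, triad (w l) (u l) (v l) →
    (∀ l, (Matrix.of (Function.curry (w l))).rank ^ 3 ≤ n ∧
      (Matrix.of (Function.curry (u l))).rank ^ 3 ≤ n ∧
      (Matrix.of (Function.curry (v l))).rank ^ 3 ≤ n) →
    (n : ℝ) ^ ((8 : ℝ) / 3 + δ) ≤ (r : ℝ)

/-- D7 candidate piece (sub-polynomial, ω-blind, = route crux `ConstantFactorHalfScale` in
spirit): a constant-factor beat at scale one-half for all large `n`. Consistent with `ω = 2`;
no proved bridge to a polynomial beat except through an amplification piece of D6 type. -/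
def ConstantFactorBeat : Prop :=
  ∃ c : ℝ, 0 < c ∧ ∃ n₀ : ℕ, ∀ n : ℕ, n₀ ≤ n → ∀ (r : ℕ) (w u v : Fin r → Fin n × Fin n → ℂ),
    matMulTensor ℂ n n n = ∑ l, triad (w l) (u l) (v l) →
    (∀ l, (Matrix.of (Function.curry (w l))).rank ^ 2 ≤ n ∧
      (Matrix.of (Function.curry (u l))).rank ^ 2 ≤ n ∧
      (Matrix.of (Function.curry (v l))).rank ^ 2 ≤ n) →
    (1 + c) * (n : ℝ) ^ ((5 : ℝ) / 2) ≤ (r : ℝ)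

end Summit.MatrixMultiplication.MatrixMultiplication.Cruxes.HalfScaleBeat.Strategist
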